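import Summits.BirchSwinnertonDyer.Rank1Residual.Additive.WildThreeResidualShapeLaws
import Summits.BirchSwinnertonDyer.Rank1Residual.O5.O5LocalShapeProofs
import HarnessLib

/-!
# The dictionary `LocIrr W 3 ↔ ShapeIrrThree W` INSTANTIATED (harvest-2 E89) — the `hloc` hypothesis of
# `Additive/WildThreeResidualShapeLaws.lean` discharged, and its two consumers made unconditional in it
# (cell `b2b-bsdres`, lane CLASS-CLOSURE, class O6 / O5, seat cc-typer-5 GEN 8 = O5/O6 typer of record)

HONEST FRAMING (cell `b2b-bsdres`, run/shared/lean/b2b/bsd-rank1-residual/, verbatim in every file):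
the goal of the cell is to DELETE the COMBINATION-SHAPED residual classes of the Birch–Swinnerton-Dyer
formula for ALL analytic-rank `≤ 1` elliptic curves over `ℚ` — assembled STRICTLY from published
theorems — so that the rank-`≤ 1` remainder becomes exactly the CONSTRUCTION-SHAPED classes, which are
TYPED (missing-input `Prop`s), NOT attempted. This is not "finishing BSD". Lane CLASS-CLOSURE
(`CLASS-CLOSURE-PLAN.md` §3.4 O6 / §3.5 O5): research routes; no claim beyond the stated classes; nothing
is booked; no mark of `RESIDUAL-MAP.md` moves. THEOREMS ONLY (glue); 0 definitions; 0 Literature facts.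

## What
`WildThreeResidualShapeLaws.lean` (cc-typer-5 GEN 7, p291651) consumed the dictionary "`W[3]|G_{ℚ₃}`
irreducible (`Additive.LocIrr W 3`, the Fouquet–Wan generic locus of `FouquetWanLocus.lean`) iff `Ψ₃` has no
root in `ℚ₃` (`Additive.ShapeIrrThree W`, V10-SHAPE IRR)" as an explicit hypothesis
`hloc : ∀ W [W.IsElliptic] [W.IsGloballyMinimal], LocIrr W 3 ↔ ShapeIrrThree W`, because harvest-2 GEN 42
was proving it in the kernel at the same hour (E89).  E89 has LANDED: the Literature lemma
`WeierstrassCurve.hasIrreducibleModPGaloisRep_three_iff_forall_not_isRoot_Ψ₃` (any field of characteristic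
`0`; `Literature/NumberTheory/EllipticCurves/ModThreeReducibleIffPsi3Root.lean`, p290642) and its Summit
corollary `O5.locIrr_three_iff_forall_not_isRoot : LocIrr W 3 ↔ ∀ r : ℚ_[3], ¬ (W/ℚ₃).Ψ₃.IsRoot r` for EVERY
elliptic `W/ℚ` (`O5/O5LocalShapeProofs.lean`, p291075) — which is `hloc` ON THE NOSE (`ShapeIrrThree`'s body;
the minimality binder is unused).  This file records the instantiation (`locIrr_three_iff_shapeIrrThree`,
`locIrr_iff_shapeIrrThree_forall` = the exact `hloc` shape) and the two consumers of GEN 7's file with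
`hloc` DISCHARGED: `kmc_three_of_fwPointClaim_of_residueA'` (class (A) of the O6 residue is served by the
announced Fouquet–Wan point shape + a non-split witness, no dictionary hypothesis) and — for the record
only, since harvest-2's `O5.localShapeTprimeThree_holds` already proves the node directly — the bridge
route `localShapeTprimeThree_of_locIrr_iff_shapeIrr` now closes too (`example`).  Also the reading of
T-O6-NG's binder: `¬ ShapeIrrThree W ↔ ¬ LocIrr W 3` (`kmc_three_of_nonGenericTransport_of_not_locIrr`).
Kernel status moved: the (A)/(B)/(C) sub-partition predicates of O6 are now tied to the tree's `LocIrr` by a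
THEOREM; nothing else changes (the `@[conjecture]` nodes of GEN 7's file are untouched; census = EVIDENCE).

References: harvest-2 `HOME/b2b-bsdres-harvest-2/gen42/E89-LocIrr3-kernel.md`; [Cremona1997] §3.8;
[SilvermanAEC2009] III.4.12; [Serre1972] §1.11; `class-closure/O6/TYPED.md` §11–§12.
-/

set_option autoImplicit false

open WeierstrassCurve Literature.NumberTheory.EllipticCurves

namespace Summit.BirchSwinnertonDyer.Rank1Residual.Additive

/-- **The dictionary, as a theorem**: `LocIrr W 3 ↔ ShapeIrrThree W` for every elliptic `W/ℚ` (harvest-2 E89: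
a subgroup `{0, ±P}` of order `3` is `G_{ℚ₃}`-stable iff `x(P) ∈ ℚ₃`).
[cite: Cremona1997, §3.8 (l = 3)] [cite: Serre1972, §1.11 Prop. 10] -/
theorem locIrr_three_iff_shapeIrrThree (W : WeierstrassCurve ℚ) [W.IsElliptic] :
    LocIrr W 3 ↔ ShapeIrrThree W :=
  O5.locIrr_three_iff_forall_not_isRoot W

/-- The exact `hloc` shape of `WildThreeResidualShapeLaws.lean` (minimality binder carried, unused). [folklore] -/
theorem locIrr_iff_shapeIrrThree_forall :
    ∀ (W : WeierstrassCurve ℚ) [W.IsElliptic] [W.IsGloballyMinimal], LocIrr W 3 ↔ ShapeIrrThree W :=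
  fun W _ _ ↦ locIrr_three_iff_shapeIrrThree W

/-- **Class (A) of the O6 residue IS the generic locus**: `WildResidueA W ↔ LocIrr W 3`. [folklore] -/
theorem wildResidueA_iff_locIrr (W : WeierstrassCurve ℚ) [W.IsElliptic] : WildResidueA W ↔ LocIrr W 3 :=
  (locIrr_three_iff_shapeIrrThree W).symm

/-- **Classes (B) and (C) lie in the NON-generic locus** (`¬ LocIrr W 3`). [folklore] -/
theorem not_locIrr_of_wildResidueB_or_C (W : WeierstrassCurve ℚ) [W.IsElliptic]
    (h : WildResidueB W ∨ WildResidueC W) : ¬ LocIrr W 3 := by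
  intro hL
  have hA : WildResidueA W := (wildResidueA_iff_locIrr W).2 hL
  obtain ⟨hB, hC⟩ := WildResidueA.not_B_not_C hA
  exact h.elim hB hC

/-- GEN 7's bridge route to O5's node closes with `hloc` discharged (the node itself is harvest-2's theorem
`O5.localShapeTprimeThree_holds`; this is the second, composed, proof — recorded as an `example`, no new name). -/
example : O5.LocalShapeTprimeThree :=
  localShapeTprimeThree_of_locIrr_iff_shapeIrr locIrr_iff_shapeIrrThree_forall

section Transport

variable {KMC : ∀ (W : WeierstrassCurve ℚ) [W.IsElliptic] [W.IsGloballyMinimal] (p : ℕ), Prop}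

/-- **Class (A) is served by the announced point shape — unconditionally in the dictionary**: GEN 7's
`kmc_three_of_fwPointClaim_of_residueA` with `hloc` instantiated by E89. [folklore] -/
theorem kmc_three_of_fwPointClaim_of_residueA' (hFW : FouquetWanPointClaimShape KMC)
    (W : WeierstrassCurve ℚ) [W.IsElliptic] [W.IsGloballyMinimal]
    (himg : Kato2004.ImageContainsSL2 W 3) (hA : WildResidueA W)
    (hwit : FWNonsplitRam W 3 ∨ ∃ (q : ℕ) (_ : Fact q.Prime), FWNonsplitAddThree W q) : KMC W 3 :=
  kmc_three_of_fwPointClaim_of_residueA hFW locIrr_iff_shapeIrrThree_forall W himg hA hwit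

/-- **T-O6-NG read on the tree's locus**: the non-generic transport shape applies exactly to the wild
big-image classes with `¬ LocIrr W 3` (its binder `¬ ShapeIrrThree W` = `¬ LocIrr W 3` by the dictionary).
[folklore] -/
theorem kmc_three_of_nonGenericTransport_of_not_locIrr (hNG : NonGenericTransportShapeThree KMC)
    (W G : WeierstrassCurve ℚ) [W.IsElliptic] [W.IsGloballyMinimal] [G.IsElliptic] [G.IsGloballyMinimal]
    (hO6 : ClassO6 W 3) (himg : Kato2004.ImageContainsSL2 W 3) (hnl : ¬ LocIrr W 3)
    (hcomp : O5.IsCompanionAtThree W G) (hseed : KMC G 3) : KMC W 3 :=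
  hNG W G hO6 himg (fun h ↦ hnl ((locIrr_three_iff_shapeIrrThree W).2 h)) hcomp hseed

end Transport

end Summit.BirchSwinnertonDyer.Rank1Residual.Additive
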